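import Literature.Combinatorics.Sahi2008.FixedCycle
import Literature.Combinatorics.Sahi2008.Symmetry
import Literature.Combinatorics.Sahi2008.Indicators

/-!
# Sahi's `E_{n+1}` with an ABSORBED member, I: the sub-family functionals `ncs`, the `R`-form and its NONNEGATIVE block recursion
# (the engine of `E_{n+1}(g, f_1,…,f_n) = E[g]·R(f) ≥ 0`, completed in `…SahiAbsorbedMember`)

Support file of the one-cut programme (crux `NoHeavyLowerTail`, stmt-CriticalPhenomena-4575; cell `prim-masterthm`, seat P3, gen 18;
`run/shared/lean/prim/prim-masterthm/prim-masterthm-p3/HIERARCHY.md` §26(e)).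

THE THEOREM.  Let `μ` be any weight on a finite type, `f_1,…,f_n, g : X → ℝ` with `g · f_i = g` pointwise for every `i` ("`g` is absorbed by every `f_i`";
for indicators: the event of `g` lies INSIDE every other event).  Then
  `E_{n+1}(g, f_1, …, f_n) = E[g] · R_n(f)`,   `R_n(f) = Σ_{T ⊆ [n]} |T|! · ncs(f|_{[n]∖T})`   (`absorbed_sahiE_eq`),
where `ncs` is the signed cycle sum `Σ_τ (−1)^{C_τ} E_τ` of the sub-family (Lieb–Sahi's complementary factor, tree `coRest`); and `R` obeys the NONNEGATIVE recursion
  `R(C) = Σ_{B ⊆ C, min C ∈ B} (|B|−1)! · (1 − E[Π_{i∈B} f_i]) · R(C ∖ B)`   (`rform_eq_sum_block`; the block expansion of `ncs` through a fixed index,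
  tree `cycleSum_eq_sum_blocks` = [LiebSahi2021, Prop. 3.4], plus the binomial identity `Σ_{B ∋ i, B ⊆ T} (|B|−1)!(|T|−|B|)! = |T|!`),
equivalently `R_n(f) = Σ_{π ⊢ [n]} Π_B (|B|−1)!(1 − E[Π_B f])` (the set-partition form; not needed formally).  Hence
  **`sahiE_nonneg_of_absorbed`**: if moreover `E[g] ≥ 0` and `E[Π_{i∈B} f_i] ≤ 1` for every nonempty `B` (e.g. `μ` a probability weight and `0 ≤ f_i ≤ 1`), then
  `E_{n+1}(g, f_1, …, f_n) ≥ 0`;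
  **`sahiE_setInd_nonneg_of_subset`**: for every probability weight and all sets `W ⊆ U_1 ∩ ⋯ ∩ U_n` (no monotonicity, no lattice, no FKG),
  `E_{n+1}(1_W, 1_{U_1}, …, 1_{U_n}) ≥ 0`.
The cases `n + 1 ≤ 3` are in the tree (`sahiE3_nonneg_of_subset`, Cov(1_U,1_W) = μ(W)(1−μ(U))); the all-orders statement with the explicit formula is new here.  It is
the value-level shadow of the order-`n` C-slot SIGN structure observed this gen for the slot functional (HIERARCHY §26(e)); the slot-level analogue is NOT implied.
Everything proved; axioms standard. [this work]
-/

noncomputable section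

namespace Summit.CriticalPhenomena.PercolationContinuityZ3.Theorems

open Finset Function Equiv Equiv.Perm
open Literature.Combinatorics.Sahi2008 Literature.Combinatorics.Sahi2008.CycleForm

namespace SahiAbsorbed

variable {α : Type*} [Fintype α] (μ : α → ℝ) {κ : Type*} [DecidableEq κ] (f : κ → α → ℝ)

/-! ### Sub-family functionals indexed by finsets -/

/-- The joint moment of the sub-family `B`: `m(B) = E_μ[Π_{j∈B} f_j]`. [this work] -/
def mom (B : Finset κ) : ℝ := ex μ (fun x => ∏ j ∈ B, f j x)

/-- The SIGNED cycle sum of the sub-family on `A`: `ncs(A) = Σ_{τ ∈ Sym(A)} (−1)^{C_τ} E_τ(f|_A)` (`= 1` for `A = ∅`, `= −E(f|_A)` otherwise;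
Lieb–Sahi's complementary factor, tree `coRest`, indexed by the members PRESENT). [this work] -/
def ncs (A : Finset κ) : ℝ :=
  ∑ τ : Perm {x // x ∈ A}, (-1 : ℝ) ^ (orbits τ).card * cycleE μ (fun j : {x // x ∈ A} => f j) τ

/-- `ncs ∅ = 1` (the empty permutation has no cycles). [this work] -/
theorem ncs_empty : ncs μ f ∅ = 1 := by
  unfold ncs
  haveI : IsEmpty {x // x ∈ (∅ : Finset κ)} := ⟨fun x => Finset.notMem_empty _ x.2⟩
  have h0 : ∀ σ : Perm {x // x ∈ (∅ : Finset κ)}, orbits σ = ∅ := fun σ => by simp [orbits]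
  rw [Fintype.sum_unique]
  simp [cycleE, h0]

/-- For nonempty `A`, `ncs(A) = −E(f|_A)` (cycle form of Sahi's functional of the sub-family). [this work] -/
theorem ncs_eq_neg_cycleSum {A : Finset κ} (hA : A.Nonempty) : ncs μ f A = -cycleSum μ (fun j : {x // x ∈ A} => f j) := by
  unfold ncs cycleSum
  rw [← sum_neg_distrib]
  refine sum_congr rfl fun τ _ => ?_
  obtain ⟨y, hy⟩ := hA
  have hpos : 0 < (orbits τ).card := card_pos.2 ⟨_, orbit_mem_orbits τ ⟨y, hy⟩⟩
  obtain ⟨m, hm⟩ : ∃ m, (orbits τ).card = m + 1 := ⟨_, (Nat.succ_pred_eq_of_pos hpos).symm⟩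
  rw [hm, Nat.add_sub_cancel, pow_succ]
  ring

/-- Transport of `ncs`-type sums along an equivalence of index types. [this work] -/
theorem signedSum_comp_equiv {β β' : Type*} [Fintype β] [DecidableEq β] [Fintype β'] [DecidableEq β'] (e : β ≃ β') (h : β' → α → ℝ) :
    ∑ τ : Perm β, (-1 : ℝ) ^ (orbits τ).card * cycleE μ (fun j => h (e j)) τ =
      ∑ τ : Perm β', (-1 : ℝ) ^ (orbits τ).card * cycleE μ h τ :=
  Fintype.sum_equiv e.permCongr _ _ fun σ => by rw [card_orbits_permCongr, cycleE_permCongr]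

omit [Fintype α] in
/-- The complement of `B' ⊆ A` inside the subtype of `A` is the subtype of `A \\ B'` (plumbing). [this work] -/
def sdiffEquiv (A : Finset κ) (B' : Finset {x // x ∈ A}) :
    {y : {x // x ∈ A} // y ∉ B'} ≃ {x // x ∈ A \ B'.map (Embedding.subtype (· ∈ A))} where
  toFun y := ⟨y.1.1, by
    rw [mem_sdiff]
    refine ⟨y.1.2, fun h => y.2 ?_⟩
    rw [mem_map] at h
    obtain ⟨z, hz, hzy⟩ := h
    have : z = y.1 := Subtype.ext hzy
    rw [← this]; exact hz⟩
  invFun x := ⟨⟨x.1, (mem_sdiff.1 x.2).1⟩, fun h => (mem_sdiff.1 x.2).2 (mem_map.2 ⟨_, h, rfl⟩)⟩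
  left_inv y := rfl
  right_inv x := rfl

/-- **Block expansion of `ncs` through a fixed index** (Lieb–Sahi's Prop. 3.4 summed over the cycles through `i`, in the signed convention):
for `i ∈ A`, `ncs(A) = −Σ_{B ⊆ A, i ∈ B} (|B|−1)! · m(B) · ncs(A ∖ B)`. [this work] -/
theorem ncs_eq_sum_block {A : Finset κ} {i : κ} (hi : i ∈ A) :
    ncs μ f A = -∑ B ∈ A.powerset.filter (fun B => i ∈ B), ((B.card - 1).factorial : ℝ) * mom μ f B * ncs μ f (A \ B) := by
  rw [ncs_eq_neg_cycleSum μ f ⟨i, hi⟩, cycleSum_eq_sum_blocks μ (fun j : {x // x ∈ A} => f j) ⟨i, hi⟩]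
  congr 1
  -- re-index the blocks `B' : Finset {x // x ∈ A}` containing `⟨i,hi⟩` by `B = B'.map val ⊆ A` containing `i`
  refine sum_bij (fun (B' : Finset {x // x ∈ A}) _ => B'.map (Embedding.subtype _)) ?_ ?_ ?_ ?_
  · intro B' hB'
    rw [mem_filter] at hB' ⊢
    refine ⟨mem_powerset.2 fun x hx => ?_, ?_⟩
    · rw [mem_map] at hx
      obtain ⟨y, _, rfl⟩ := hx
      exact y.2
    · exact mem_map.2 ⟨⟨i, hi⟩, hB'.2, rfl⟩
  · intro B₁ _ B₂ _ h
    exact (map_injective (Embedding.subtype _)) h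
  · intro B hB
    rw [mem_filter, mem_powerset] at hB
    refine ⟨B.subtype (· ∈ A), ?_, ?_⟩
    · rw [mem_filter]
      exact ⟨mem_univ _, by rw [mem_subtype]; exact hB.2⟩
    · rw [subtype_map]
      exact filter_true_of_mem hB.1
  · intro B' hB'
    have hcard : (B'.map (Embedding.subtype (· ∈ A))).card = B'.card := card_map _
    have hmom : ex μ (fun x => ∏ j ∈ B', (fun j : {x // x ∈ A} => f j) j x) = mom μ f (B'.map (Embedding.subtype (· ∈ A))) := by
      unfold mom ex
      refine sum_congr rfl fun x _ => ?_
      dsimp only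
      rw [prod_map]
      rfl
    have hco : coRest μ (fun j : {x // x ∈ A} => f j) B' = ncs μ f (A \ B'.map (Embedding.subtype (· ∈ A))) := by
      unfold coRest ncs
      convert signedSum_comp_equiv μ (sdiffEquiv A B') (fun j : {x // x ∈ A \ B'.map (Embedding.subtype (· ∈ A))} => f j) using 3
      rfl
    rw [hcard, hmom, hco]
    ring

/-! ### The `R`-form and its nonnegative block recursion -/

/-- `R(C) = Σ_{T ⊆ C} |T|! · ncs(C ∖ T)`. [this work] -/
def rform (C : Finset κ) : ℝ := ∑ T ∈ C.powerset, (T.card.factorial : ℝ) * ncs μ f (C \ T)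

/-- `R(∅) = 1`. [this work] -/
theorem rform_empty : rform μ f ∅ = 1 := by
  unfold rform
  rw [powerset_empty, sum_singleton, card_empty, Nat.factorial_zero, Nat.cast_one, one_mul, sdiff_self, Finset.bot_eq_empty, ncs_empty]

omit [Fintype α] in
/-- The binomial regrouping identity `Σ_{B ⊆ T, i ∈ B} (|B|−1)!·|T ∖ B|! = |T|!` (`i ∈ T`). [this work] -/
theorem sum_block_factorial (T : Finset κ) {i : κ} (hi : i ∈ T) :
    ∑ B ∈ T.powerset.filter (fun B => i ∈ B), (((B.card - 1).factorial : ℕ) : ℝ) * (((T \ B).card.factorial : ℕ) : ℝ) =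
      ((T.card.factorial : ℕ) : ℝ) := by
  -- `B ↦ B.erase i` : blocks through `i` ≃ subsets of `T.erase i`
  have hbij : ∑ B ∈ T.powerset.filter (fun B => i ∈ B), (((B.card - 1).factorial : ℕ) : ℝ) * (((T \ B).card.factorial : ℕ) : ℝ) =
      ∑ S ∈ (T.erase i).powerset, ((S.card.factorial : ℕ) : ℝ) * ((((T.erase i) \ S).card.factorial : ℕ) : ℝ) := by
    refine sum_bij (fun B _ => B.erase i) ?_ ?_ ?_ ?_
    · intro B hB
      rw [mem_filter, mem_powerset] at hB
      exact mem_powerset.2 (erase_subset_erase i hB.1)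
    · intro B₁ hB₁ B₂ hB₂ h
      rw [mem_filter] at hB₁ hB₂
      rw [← insert_erase hB₁.2, ← insert_erase hB₂.2, h]
    · intro S hS
      rw [mem_powerset] at hS
      refine ⟨insert i S, ?_, ?_⟩
      · rw [mem_filter, mem_powerset]
        refine ⟨?_, mem_insert_self i S⟩
        intro x hx
        rcases mem_insert.1 hx with rfl | hx
        · exact hi
        · exact mem_of_mem_erase (hS hx)
      · have : i ∉ S := fun h => notMem_erase i T (hS h)
        rw [erase_insert this]
    · intro B hB
      rw [mem_filter, mem_powerset] at hB
      have h1 : (B.erase i).card = B.card - 1 := card_erase_of_mem hB.2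
      have h2 : (T.erase i) \ B.erase i = T \ B := by
        ext x
        simp only [mem_sdiff, mem_erase]
        constructor
        · rintro ⟨⟨hxi, hxT⟩, h⟩
          exact ⟨hxT, fun hxB => h ⟨hxi, hxB⟩⟩
        · rintro ⟨hxT, hxB⟩
          have hxi : x ≠ i := fun h => hxB (h ▸ hB.2)
          exact ⟨⟨hxi, hxT⟩, fun h => hxB h.2⟩
      rw [h1, h2]
  rw [hbij]
  rw [sum_congr rfl fun S hS => by rw [card_sdiff_of_subset (mem_powerset.1 hS)],
    Finset.sum_powerset_apply_card (fun k => ((k.factorial : ℕ) : ℝ) * ((((T.erase i).card - k).factorial : ℕ) : ℝ))]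
  simp only [nsmul_eq_mul]
  have ht : (T.erase i).card + 1 = T.card := by rw [card_erase_of_mem hi]; exact Nat.sub_add_cancel (card_pos.2 ⟨i, hi⟩)
  have hterm : ∀ k ∈ range ((T.erase i).card + 1),
      (((T.erase i).card.choose k : ℕ) : ℝ) * (((k.factorial : ℕ) : ℝ) * ((((T.erase i).card - k).factorial : ℕ) : ℝ)) =
        (((T.erase i).card.factorial : ℕ) : ℝ) := by
    intro k hk
    rw [mem_range] at hk
    have := Nat.choose_mul_factorial_mul_factorial (Nat.lt_succ_iff.1 hk)
    rw [← this]
    push_cast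
    ring
  rw [sum_congr rfl hterm, sum_const, card_range, nsmul_eq_mul, ← ht, Nat.factorial_succ]
  push_cast
  ring

/-- Re-indexing the subsets of `C` above `B ⊆ C`: `Σ_{T' ⊆ C ∖ B} φ(B ∪ T') = Σ_{T ⊆ C, B ⊆ T} φ(T)`. [this work] -/
theorem sum_powerset_sdiff_union {B C : Finset κ} (hBC : B ⊆ C) (φ : Finset κ → ℝ) :
    ∑ T' ∈ (C \ B).powerset, φ (B ∪ T') = ∑ T ∈ C.powerset.filter (fun T => B ⊆ T), φ T := by
  refine sum_bij (fun T' _ => B ∪ T') ?_ ?_ ?_ ?_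
  · intro T' hT'
    rw [mem_powerset] at hT'
    rw [mem_filter, mem_powerset]
    exact ⟨union_subset hBC (hT'.trans sdiff_subset), subset_union_left⟩
  · intro T₁ hT₁ T₂ hT₂ h
    rw [mem_powerset] at hT₁ hT₂
    have d1 : Disjoint B T₁ := disjoint_of_subset_right hT₁ disjoint_sdiff
    have d2 : Disjoint B T₂ := disjoint_of_subset_right hT₂ disjoint_sdiff
    have e1 : (B ∪ T₁) \ B = T₁ := by rw [union_sdiff_left, sdiff_eq_self_of_disjoint d1.symm]
    have e2 : (B ∪ T₂) \ B = T₂ := by rw [union_sdiff_left, sdiff_eq_self_of_disjoint d2.symm]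
    rw [← e1, ← e2, h]
  · intro T hT
    rw [mem_filter, mem_powerset] at hT
    refine ⟨T \ B, mem_powerset.2 (sdiff_subset_sdiff hT.1 subset_rfl), ?_⟩
    rw [union_sdiff_of_subset hT.2]
  · intro T' _; rfl

/-- **The nonnegative block recursion of `R`** (paper: Prop. 3.4 through the index `i` + the binomial regrouping): for `i ∈ C`,
`R(C) = Σ_{B ⊆ C, i ∈ B} (|B|−1)!·(1 − m(B))·R(C ∖ B)`. [this work] -/
theorem rform_eq_sum_block {C : Finset κ} {i : κ} (hi : i ∈ C) :
    rform μ f C = ∑ B ∈ C.powerset.filter (fun B => i ∈ B), (((B.card - 1).factorial : ℕ) : ℝ) * (1 - mom μ f B) * rform μ f (C \ B) := by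
  -- split `1 - m(B)`
  have hsplit : ∑ B ∈ C.powerset.filter (fun B => i ∈ B), (((B.card - 1).factorial : ℕ) : ℝ) * (1 - mom μ f B) * rform μ f (C \ B) =
      (∑ B ∈ C.powerset.filter (fun B => i ∈ B), (((B.card - 1).factorial : ℕ) : ℝ) * rform μ f (C \ B)) -
        ∑ B ∈ C.powerset.filter (fun B => i ∈ B), (((B.card - 1).factorial : ℕ) : ℝ) * mom μ f B * rform μ f (C \ B) := by
    rw [← sum_sub_distrib]; exact sum_congr rfl fun B _ => by ring
  rw [hsplit]
  -- PART 1: `Σ_{B ∋ i} (|B|−1)! R(C∖B) = Σ_{T ∋ i} |T|! ncs(C∖T)`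
  have part1 : ∑ B ∈ C.powerset.filter (fun B => i ∈ B), (((B.card - 1).factorial : ℕ) : ℝ) * rform μ f (C \ B) =
      ∑ T ∈ C.powerset.filter (fun T => i ∈ T), ((T.card.factorial : ℕ) : ℝ) * ncs μ f (C \ T) := by
    -- expand R(C \ B) and re-index T' ↦ T = B ∪ T'
    have h1 : ∀ B ∈ C.powerset.filter (fun B => i ∈ B), (((B.card - 1).factorial : ℕ) : ℝ) * rform μ f (C \ B) =
        ∑ T ∈ C.powerset.filter (fun T => B ⊆ T), (((B.card - 1).factorial : ℕ) : ℝ) * ((((T \ B).card.factorial : ℕ) : ℝ) * ncs μ f (C \ T)) := by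
      intro B hB
      rw [mem_filter, mem_powerset] at hB
      unfold rform
      rw [mul_sum, ← sum_powerset_sdiff_union hB.1 (fun T => (((B.card - 1).factorial : ℕ) : ℝ) * ((((T \ B).card.factorial : ℕ) : ℝ) * ncs μ f (C \ T)))]
      refine sum_congr rfl fun T' hT' => ?_
      rw [mem_powerset] at hT'
      have d : Disjoint B T' := disjoint_of_subset_right hT' disjoint_sdiff
      have e1 : (B ∪ T') \ B = T' := by rw [union_sdiff_left, sdiff_eq_self_of_disjoint d.symm]
      have e2 : C \ (B ∪ T') = (C \ B) \ T' := by
        ext x; simp only [mem_sdiff, mem_union, not_or]; tauto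
      rw [e1, e2]
    rw [sum_congr rfl h1]
    -- swap the sums: pairs (B ∋ i, T ⊇ B) ↔ (T ∋ i, B ⊆ T with i ∈ B)
    rw [sum_comm' (s' := fun T => T.powerset.filter (fun B => i ∈ B)) (t' := C.powerset.filter (fun T => i ∈ T))]
    · refine sum_congr rfl fun T hT => ?_
      rw [mem_filter, mem_powerset] at hT
      have := sum_block_factorial T hT.2
      have hre : ∑ B ∈ T.powerset.filter (fun B => i ∈ B), (((B.card - 1).factorial : ℕ) : ℝ) * ((((T \ B).card.factorial : ℕ) : ℝ) * ncs μ f (C \ T)) =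
          (∑ B ∈ T.powerset.filter (fun B => i ∈ B), (((B.card - 1).factorial : ℕ) : ℝ) * (((T \ B).card.factorial : ℕ) : ℝ)) * ncs μ f (C \ T) := by
        rw [sum_mul]; exact sum_congr rfl fun B _ => by ring
      rw [hre, this]
    · intro B T
      simp only [mem_filter, mem_powerset]
      constructor
      · rintro ⟨⟨hBC, hiB⟩, hTC, hBT⟩
        exact ⟨⟨hBT, hiB⟩, hTC, hBT hiB⟩
      · rintro ⟨⟨hBT, hiB⟩, hTC, _⟩
        exact ⟨⟨hBT.trans hTC, hiB⟩, hTC, hBT⟩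
  -- PART 2: `Σ_{B ∋ i} (|B|−1)! m(B) R(C∖B) = −Σ_{T ∌ i} |T|! ncs(C∖T)` (block expansion of `ncs (C ∖ T)` through `i`)
  have part2 : ∑ B ∈ C.powerset.filter (fun B => i ∈ B), (((B.card - 1).factorial : ℕ) : ℝ) * mom μ f B * rform μ f (C \ B) =
      -∑ T ∈ C.powerset.filter (fun T => i ∉ T), ((T.card.factorial : ℕ) : ℝ) * ncs μ f (C \ T) := by
    have h1 : ∀ B ∈ C.powerset.filter (fun B => i ∈ B), (((B.card - 1).factorial : ℕ) : ℝ) * mom μ f B * rform μ f (C \ B) =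
        ∑ T ∈ (C \ B).powerset, ((T.card.factorial : ℕ) : ℝ) * ((((B.card - 1).factorial : ℕ) : ℝ) * mom μ f B * ncs μ f ((C \ T) \ B)) := by
      intro B hB
      unfold rform
      rw [mul_sum]
      refine sum_congr rfl fun T hT => ?_
      rw [sdiff_sdiff_comm]
      ring
    rw [sum_congr rfl h1]
    rw [sum_comm' (s' := fun T => (C \ T).powerset.filter (fun B => i ∈ B)) (t' := C.powerset.filter (fun T => i ∉ T))]
    · rw [← sum_neg_distrib]
      refine sum_congr rfl fun T hT => ?_
      rw [mem_filter, mem_powerset] at hT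
      have hiCT : i ∈ C \ T := mem_sdiff.2 ⟨hi, hT.2⟩
      rw [← mul_sum, ncs_eq_sum_block μ f hiCT]
      ring
    · intro B T
      simp only [mem_filter, mem_powerset]
      constructor
      · rintro ⟨⟨hBC, hiB⟩, hT⟩
        refine ⟨⟨fun x hx => mem_sdiff.2 ⟨hBC hx, fun hxT => (mem_sdiff.1 (hT hxT)).2 hx⟩, hiB⟩,
          fun x hxT => (mem_sdiff.1 (hT hxT)).1, fun hiT => (mem_sdiff.1 (hT hiT)).2 hiB⟩
      · rintro ⟨⟨hB, hiB⟩, hTC, hiT⟩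
        exact ⟨⟨fun x hx => (mem_sdiff.1 (hB hx)).1, hiB⟩,
          fun x hxT => mem_sdiff.2 ⟨hTC hxT, fun hxB => (mem_sdiff.1 (hB hxB)).2 hxT⟩⟩
  rw [part1, part2, sub_neg_eq_add, sum_filter_add_sum_filter_not]
  rfl

/-- **`R ≥ 0`** whenever every nonempty joint moment is `≤ 1` (strong induction along the block recursion). [this work] -/
theorem rform_nonneg (hm : ∀ B : Finset κ, B.Nonempty → mom μ f B ≤ 1) (C : Finset κ) : 0 ≤ rform μ f C := by
  induction C using Finset.strongInduction with
  | H C ih =>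
    rcases C.eq_empty_or_nonempty with rfl | ⟨i, hi⟩
    · rw [rform_empty]; exact zero_le_one
    · rw [rform_eq_sum_block μ f hi]
      refine sum_nonneg fun B hB => ?_
      rw [mem_filter, mem_powerset] at hB
      refine mul_nonneg (mul_nonneg (Nat.cast_nonneg _) (sub_nonneg.2 (hm B ⟨i, hB.2⟩))) (ih _ ?_)
      exact sdiff_ssubset hB.1 ⟨i, hB.2⟩

end SahiAbsorbed

end Summit.CriticalPhenomena.PercolationContinuityZ3.Theorems
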